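import Summits.QuantumFields.YangMills.Theorems.UnitScaleTiltProp7HPcolNegCommutatorLatticeLetters
import Summits.QuantumFields.YangMills.Theorems.UnitScaleTiltProp7TPrintDefs
import Literature.MathematicalPhysics.QuantumFieldTheory.Balaban1983to89.T3SectALandauChart
import Literature.MathematicalPhysics.QuantumFieldTheory.Balaban1983to89.BlockAveragingZd
import Summits.QuantumFields.YangMills.Theorems.UnitScaleTiltProp7HPcolNegPauliExp
import Summits.QuantumFields.YangMills.Theorems.UnitScaleTiltProp7HPcolNegEmlPairing
import HarnessLib

/-!
# NEG-hPcol N3 (★★OWNER WORD 38 «GO», px12 g11; SPEC-0 e654b2a4 N3a∕N3b; LOCATE v2.1 8aced68d): **THE (0.4) BLOCK AVERAGE OF THE «AXIS-PER-DIRECTION,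
# BLOCK-PERIODIC» PAULI LATTICE IS EXACTLY THE TRIVIAL FIELD AT EVERY LEVEL** — `U_φ := expHermField (b ↦ φ_{b.dir}((b.src b.dir).val % L) • σ_{b.dir})` with `Σ_{r<L} φ_μ(r) = 0`,
# `|φ| ≤ δ ≤ 1∕(40L)`; in particular px12's commutator lattice `φ_μ(r) = s·θ(r)`, `θ = (1, −1, 0, …)` (SPEC N3a `spec_emlAvgU_field_eq_one`, N3b `spec_emlIterU_field_eq_one`).

Cell `ym3-torus`, width seat `ym3-torus-px12` (gen 11).  THEOREMS ONLY (0 `def`, 0 `sorry`); `--supports stmt-QuantumFields-19200 --as helper`, count-neutral.  WHY: the explicit stratum-(c)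
witness behind footnote 17v (the EX display row `hPcol` of S42ᴸ is not inhabitable on backgrounds whose EML average is reducible while they are not; LIFT-THREAD 2 is the repair of record).
THE MECHANISM ([Balaban1987RG1] (0.4) `Ū(c) = exp[mean_i log U(loop_i)]·U(straight)`, tree `Prop8ChartDefs.emlAvgU`): (§1) a level-0 field whose link value depends only on the direction
and on the running coordinate mod `L` pulls back `L`-periodically to `ℤ³` (`pull_add_L`, `hol_pull_add_L`; `L ∣ 2L^{m+K}`); (§2) if moreover every straight block-length run transports to `1`,
the loop variable at index `(r, σ, σ′)` is `A_σ(n)·A_{σ′}(n)⁻¹` (`loopHolU_eq_stair_mul_stair_inv`: `hol_append`, `disp_stairWord`, `hol_revWord'`, periodicity) and swapping `σ ↔ σ′`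
INVERTS it (`loopHolU_swap_eq_inv`); (§3) `eml = 1` + unit line ⇒ `Ū(c) = 1`, and one trivial step ⇒ all iterates trivial; (§4) for the Pauli field: link values (`coe_bgUnits_expHermField`),
the residue property, `U1`-valuedness, and the closed form of straight runs `↑U(x → x + t e_μ) = ↑expHerm((Σ_{j<t} φ_μ((a+j).val % L)) • σ_μ)` (px6 g11 ✓`Prop7HPcolNegPauliExp.expHerm_smul_pauli_mul`);
(§5) `‖V(Γ) − 1‖ ≤ |Γ|·δ` for `U1`-valued links, hence `‖U(loop) − 1‖ ≤ 2·3·((L−1)∕2)·δ ≤ 1∕3`, and routeR-w2 g11 ✓`Prop7HPcolNegEmlPairing.eml_coe_units_eq_one_of_involutive_inv_pairing`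
with the involution `(r, σ, σ′) ↦ (r, σ′, σ)` gives `eml = 1` ⇒ ★★`emlAvgU_pauliField_eq_one`, ★★`emlIterU_pauliField_eq_one`; (§6) the SPEC statements N3a∕N3b token for token.
HONEST SCOPE: lattice bookkeeping about ONE explicit configuration; N3c (`U_s ∈ RegPr ρ` for small `s`), N4, N5, N6 are separate pieces; nothing of the 13 print rows, `hThm2S`, EX or the
crux is proved; not an item refutation, not a display event; YM₃ on T³ = rung R3 — NOT d = 4, NOT infinite volume, NOT a mass gap, NOT Clay; YM gap NOT proved.

References: T. Bałaban, CMP **109** (1987) 249–301 [Balaban1987RG1] ((0.3)–(0.4) pp.252–253, (0.11) p.253); CMP **98** (1985) 17–51 [Balaban1985Averaging] ((8)–(9) p.18, (19) p.21,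
pp.24–25); CMP **102** (1985) 277–309 [Balaban1985Variational] ((112) p.294).
-/

set_option autoImplicit false

noncomputable section

open scoped BigOperators Matrix.Norms.L2Operator Matrix

namespace Summit.QuantumFields.YangMills.Theorems.Prop7HPcolNegCommutatorLattice

open Summit.QuantumFields.YangMills.Theorems.Prop7HPcolNegCommutatorLatticeLetters

open Literature.MathematicalPhysics.QuantumFieldTheory.Balaban1983to89
open Literature.MathematicalPhysics.QuantumFieldTheory.Balaban1983to89.T3ContinuumYM3Torus
open Literature.MathematicalPhysics.QuantumFieldTheory.Balaban1983to89.T3SectALandauChart (bgUnits)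
open Literature.MathematicalPhysics.QuantumLattice (spinHalfPauli)
open B7Prop1Explicit renaming Site → LSite
open B7Prop1Explicit (Letter e e_apply disp disp_cons disp_replicate disp_revWord hol hol_append hol_revWord' stepHol stepHol_true stepHol_false
  revWord revWord_cons revWord_nil)
open B7Prop1Explicit.Letter (vec_true vec_false)
open B10Eq27TorusAxialLog (holT pull pull_apply hol_pull hol_pull_zero transl transl_apply unitsField toUField val_unitsField val_suIncl)
open T4Continuum (stairWord loopWord wordRev)
open BlockAveraging (Idx off)
open BlockAveragingZd (disp_stairWord length_stairWord l1_offZ_le offZ)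
open Summit.QuantumFields.YangMills.Theorems.Prop7TPrint (expHermField expHerm coe_expHerm expHermField_apply)
open Summit.QuantumFields.YangMills.Theorems.Prop8Chart (emlIterU emlAvgU loopHolU coe_emlAvgU emlIterU_succ emlAvgU_one)
open Summit.QuantumFields.YangMills.Theorems.Prop7HPcolNegPauliExp (coe_expHerm_smul_pauli expHerm_smul_pauli_mul expHerm_smul_pauli_zero norm_exp_I_smul_pauli_sub_one_le)
open Summit.QuantumFields.YangMills.Theorems.Prop7HPcolNegEmlPairing (eml_coe_units_eq_one_of_involutive_inv_pairing)
open B7Prop2Explicit (unitaryUnits unitaryUnits_le_U1)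
open B7Prop1Explicit (U1 hol_mem stepHol_mem norm_inv_sub_one_le l1)

/-! ## §4 The explicit «axis-per-direction» Pauli field `U_φ = expHermField (b ↦ φ(b.dir, (b.src b.dir).val % L) • σ_{b.dir})` on a `T³` member -/

section Pauli

variable (F : T3Family) (K : ℕ)

/-- `L ∣ 2·L^{m+K}`: the block side divides the number of sites per direction of the finest torus (`m ≥ 1`). [cite: Balaban1985UV3, (1)-(3) p.256] -/
theorem L_dvd_sitesPerDir_zero : (F.P K).L ∣ (F.P K).sitesPerDir 0 := by
  show F.L ∣ 2 * F.L ^ (F.m + K - 0)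
  rw [Nat.sub_zero]
  exact Dvd.dvd.mul_left (dvd_pow_self F.L (by have := F.hm; omega)) 2

/-- THE LINK VALUE of the Pauli field, read in `M₂(ℂ)`: `↑(V⟨x,μ⟩) = ↑(expHerm (φ_μ((x μ).val % L) • σ_μ))`. [cite: Balaban1985Variational, (112) p.294] -/
theorem coe_bgUnits_expHermField (X : PBond (F.P K) 0 → Matrix (Fin 2) (Fin 2) ℂ) (b : PBond (F.P K) 0) :
    ((bgUnits F K (expHermField X) b : (Matrix (Fin 2) (Fin 2) ℂ)ˣ) : Matrix (Fin 2) (Fin 2) ℂ) =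
      ((expHerm (X b) : Matrix.specialUnitaryGroup (Fin 2) ℂ) : Matrix (Fin 2) (Fin 2) ℂ) := by
  show ((unitsField (toUField (expHermField X)) b : (Matrix (Fin 2) (Fin 2) ℂ)ˣ) : Matrix (Fin 2) (Fin 2) ℂ) = _
  rw [val_unitsField]
  rfl

/-- The Pauli field has the RESIDUE PROPERTY. [folklore] -/
theorem residue_property_pauliField (φ : Fin (F.P K).d → ℕ → ℝ) :
    ∀ b b' : PBond (F.P K) 0, b.dir = b'.dir → (b.src b.dir).val % (F.P K).L = (b'.src b'.dir).val % (F.P K).L →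
      bgUnits F K (expHermField (fun b : PBond (F.P K) 0 => (((φ b.dir ((b.src b.dir).val % F.L)) : ℝ) : ℂ) • spinHalfPauli b.dir)) b =
      bgUnits F K (expHermField (fun b : PBond (F.P K) 0 => (((φ b.dir ((b.src b.dir).val % F.L)) : ℝ) : ℂ) • spinHalfPauli b.dir)) b' := by
  rintro ⟨x, μ⟩ ⟨x', μ'⟩ hdir hres
  simp only at hdir
  subst hdir
  have hres' : (x μ).val % F.L = (x' μ).val % F.L := hres
  apply Units.ext
  rw [coe_bgUnits_expHermField, coe_bgUnits_expHermField]
  simp only [hres']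

/-- The Pauli field is unitary-valued, hence in the engine's class `U1`. [cite: Balaban1985Averaging, (19) p.21] -/
theorem pull_pauliField_mem_U1 (X : PBond (F.P K) 0 → Matrix (Fin 2) (Fin 2) ℂ) (y : Site (F.P K) 0) :
    ∀ (x : LSite (F.P K).d) (κ : Fin (F.P K).d), pull (bgUnits F K (expHermField X)) y x κ ∈ U1 (Matrix (Fin 2) (Fin 2) ℂ) := by
  intro x κ
  letI : CStarAlgebra (Matrix (Fin 2) (Fin 2) ℂ) := B10Eq29TubeLine.cstarAlgebraMatrix 2
  rw [pull_apply]
  exact B10Eq27TorusAxialLog.U1_of_unitaryUnits (B10Eq27TorusAxialLog.unitsField_mem_unitaryUnits _) _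

/-- **UNIT LINE PRODUCTS**, general step count: the straight run of `t` steps `+e_μ` from `z` transports to `expHerm ((Σ_{j<t} φ_μ((a + j).val % L)) • σ_μ)`,
`a` the running coordinate of the start. [cite: Balaban1987RG1, (0.4) p.253] -/
theorem coe_hol_pull_pauliField_replicate (φ : Fin (F.P K).d → ℕ → ℝ) (y : Site (F.P K) 0) (μ : Fin (F.P K).d) :
    ∀ (t : ℕ) (z : LSite (F.P K).d),
    ((hol (pull (bgUnits F K (expHermField (fun b : PBond (F.P K) 0 => (((φ b.dir ((b.src b.dir).val % F.L)) : ℝ) : ℂ) • spinHalfPauli b.dir))) y) z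
        (List.replicate t (μ, true)) : (Matrix (Fin 2) (Fin 2) ℂ)ˣ) : Matrix (Fin 2) (Fin 2) ℂ) =
      ((expHerm ((((∑ j ∈ Finset.range t, φ μ (((transl y z μ) + (j : ZMod ((F.P K).sitesPerDir 0))).val % F.L)) : ℝ) : ℂ) • spinHalfPauli μ) :
        Matrix.specialUnitaryGroup (Fin 2) ℂ) : Matrix (Fin 2) (Fin 2) ℂ)
  | 0, z => by
    rw [List.replicate_zero, Finset.sum_range_zero, expHerm_smul_pauli_zero]
    rfl
  | t + 1, z => by
    rw [List.replicate_succ, show hol _ z (((μ, true) : Letter (F.P K).d) :: List.replicate t (μ, true)) =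
        stepHol _ z (μ, true) * hol _ (z + Letter.vec ((μ, true) : Letter (F.P K).d)) (List.replicate t (μ, true)) from rfl,
      stepHol_true, vec_true, Units.val_mul, coe_hol_pull_pauliField_replicate φ y μ t (z + e μ), pull_apply, coe_bgUnits_expHermField,
      ← Submonoid.coe_mul, expHerm_smul_pauli_mul, Finset.sum_range_succ' (fun j => φ μ (((transl y z μ) + (j : ZMod ((F.P K).sitesPerDir 0))).val % F.L))]
    congr 4
    rw [add_comm]
    congr 1
    · refine Finset.sum_congr rfl fun j _ => ?_
      rw [B10Eq27TorusAxialLog.transl_add_e, Site.shift_apply]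
      simp only [if_true]
      push_cast
      ring_nf
    · simp

end Pauli

/-! ## §5 Smallness of the loop variables; `Ū_φ ≡ 1`; every iterate `≡ 1` -/

section Assembly

variable (F : T3Family) (K : ℕ)

/-- `off = offZ` (NODE 00's centred offset is the engine's). [folklore] -/
theorem off_eq_offZ (r : Fin (F.P K).d → Fin (F.P K).L) : off r = offZ (F.P K).L r := rfl

/-- A complete-residue reindexing: `Σ_{j<L} f((a + j) % L) = Σ_{r<L} f r`. [folklore] -/
theorem sum_range_mod_shift (f : ℕ → ℝ) (a L : ℕ) (hL : 0 < L) :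
    ∑ j ∈ Finset.range L, f ((a + j) % L) = ∑ r ∈ Finset.range L, f r := by
  haveI : NeZero L := ⟨hL.ne'⟩
  rw [Finset.sum_range (fun j => f ((a + j) % L)), Finset.sum_range f]
  let k : Fin L := ⟨a % L, Nat.mod_lt _ hL⟩
  have hk : ∀ j : Fin L, (a + (j : ℕ)) % L = ((j + k : Fin L) : ℕ) := by
    intro j
    rw [Fin.val_add, show ((k : Fin L) : ℕ) = a % L from rfl, add_comm a, Nat.add_mod (j : ℕ) a, Nat.add_mod (j : ℕ) (a % L), Nat.mod_mod]
  simp_rw [hk]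
  exact Equiv.sum_comp (Equiv.addRight k) (fun j : Fin L => f (j : ℕ))

/-- **UNIT LINE PRODUCTS** for the Pauli field with `Σ_{r<L} φ_μ(r) = 0`: every straight block-length run transports to `1`. [cite: Balaban1987RG1, (0.4) p.253] -/
theorem hol_pull_pauliField_line_eq_one (φ : Fin (F.P K).d → ℕ → ℝ) (hφ : ∀ μ, ∑ r ∈ Finset.range F.L, φ μ r = 0)
    (y : Site (F.P K) 0) (z : LSite (F.P K).d) (μ : Fin (F.P K).d) :
    hol (pull (bgUnits F K (expHermField (fun b : PBond (F.P K) 0 => (((φ b.dir ((b.src b.dir).val % F.L)) : ℝ) : ℂ) • spinHalfPauli b.dir))) y) z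
      (List.replicate (F.P K).L (μ, true)) = 1 := by
  apply Units.ext
  rw [coe_hol_pull_pauliField_replicate, Units.val_one]
  have hsum : ∑ j ∈ Finset.range (F.P K).L, φ μ (((transl y z μ) + (j : ZMod ((F.P K).sitesPerDir 0))).val % F.L) = 0 := by
    have h1 : ∀ j : ℕ, ((transl y z μ) + (j : ZMod ((F.P K).sitesPerDir 0))).val % F.L = ((transl y z μ).val + j) % F.L :=
      fun j => val_add_natCast_mod_eq' (L_dvd_sitesPerDir_zero F K) _ _
    simp_rw [h1]
    rw [show (F.P K).L = F.L from rfl, sum_range_mod_shift (φ μ) _ _ (by have := F.hL.2; omega)]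
    exact hφ μ
  rw [hsum, expHerm_smul_pauli_zero]
  rfl

/-- **SMALLNESS OF THE (0.4) LOOP VARIABLES** of the Pauli field: `‖U(loop) − 1‖ ≤ 3(L−1)·δ` when every link is within `δ` of `1`. [cite: Balaban1987RG1, (0.4) p.253] -/
theorem norm_loopHolU_pauliField_sub_one_le (φ : Fin (F.P K).d → ℕ → ℝ) (hφ : ∀ μ, ∑ r ∈ Finset.range F.L, φ μ r = 0)
    {δ : ℝ} (hδ0 : 0 ≤ δ) (hδ : ∀ μ r, |φ μ r| ≤ δ) (c : PBond (F.P K) 1) (i : Idx (F.P K)) :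
    ‖((loopHolU (bgUnits F K (expHermField (fun b : PBond (F.P K) 0 => (((φ b.dir ((b.src b.dir).val % F.L)) : ℝ) : ℂ) • spinHalfPauli b.dir))) c i :
        (Matrix (Fin 2) (Fin 2) ℂ)ˣ) : Matrix (Fin 2) (Fin 2) ℂ) - 1‖ ≤ 2 * (3 * ((F.L - 1) / 2 : ℕ)) * δ := by
  letI : CStarAlgebra (Matrix (Fin 2) (Fin 2) ℂ) := B10Eq29TubeLine.cstarAlgebraMatrix 2
  set V := bgUnits F K (expHermField (fun b : PBond (F.P K) 0 => (((φ b.dir ((b.src b.dir).val % F.L)) : ℝ) : ℂ) • spinHalfPauli b.dir)) with hVdef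
  have hU1 : ∀ (x : LSite (F.P K).d) (κ : Fin (F.P K).d), pull V (emb c.src) x κ ∈ U1 (Matrix (Fin 2) (Fin 2) ℂ) :=
    pull_pauliField_mem_U1 F K _ (emb c.src)
  have hlink : ∀ (x : LSite (F.P K).d) (κ : Fin (F.P K).d), ‖((pull V (emb c.src) x κ : (Matrix (Fin 2) (Fin 2) ℂ)ˣ) : Matrix (Fin 2) (Fin 2) ℂ) - 1‖ ≤ δ := by
    intro x κ
    rw [pull_apply, hVdef, coe_bgUnits_expHermField, coe_expHerm_smul_pauli]
    exact (norm_exp_I_smul_pauli_sub_one_le _ _).trans (hδ _ _)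
  rw [loopHolU_eq_stair_mul_stair_inv (L_dvd_sitesPerDir_zero F K) V (residue_property_pauliField F K φ) (hol_pull_pauliField_line_eq_one F K φ hφ),
    Units.val_mul]
  have hA := norm_coe_hol_sub_one_le_length_mul hU1 hlink 0 (stairWord i.2.1 (off i.1))
  have hB := norm_coe_hol_sub_one_le_length_mul hU1 hlink 0 (stairWord i.2.2 (off i.1))
  have hB' := (norm_inv_sub_one_le (hol_mem hU1 0 (stairWord i.2.2 (off i.1)))).trans hB
  have hlen : ∀ σ : Equiv.Perm (Fin (F.P K).d), ((stairWord σ (off i.1)).length : ℝ) ≤ (3 * ((F.L - 1) / 2 : ℕ) : ℕ) := by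
    intro σ
    rw [length_stairWord, off_eq_offZ]
    have hodd : (F.P K).L = 2 * ((F.L - 1) / 2) + 1 := by
      show F.L = _; obtain ⟨k, hk⟩ := F.hL.1; omega
    exact_mod_cast l1_offZ_le hodd i.1
  have h1 := B8Ineq170.norm_mul_sub_one_le_of_norm_le_one (b := (((hol (pull V (emb c.src)) 0 (stairWord i.2.2 (off i.1)))⁻¹ : (Matrix (Fin 2) (Fin 2) ℂ)ˣ) : Matrix (Fin 2) (Fin 2) ℂ))
    (hol_mem hU1 0 (stairWord i.2.1 (off i.1))).1
  have hl1 := hlen i.2.1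
  have hl2 := hlen i.2.2
  have hm : (0 : ℝ) ≤ ((3 * ((F.L - 1) / 2 : ℕ) : ℕ) : ℝ) := by positivity
  push_cast at hl1 hl2 hm ⊢
  simp only [Matrix.coe_units_inv] at h1 hB' ⊢
  nlinarith [mul_le_mul_of_nonneg_right hl1 hδ0, mul_le_mul_of_nonneg_right hl2 hδ0]

/-- ★★ **`Ū_φ ≡ 1`: ONE (0.4) STEP AVERAGES THE PAULI FIELD TO THE TRIVIAL FIELD** (unit line products, `L`-periodicity, the `σ ↔ σ′` pairing, N1's `eml` lemma, smallness).
[cite: Balaban1987RG1, (0.4) p.253] -/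
theorem emlAvgU_pauliField_eq_one (φ : Fin (F.P K).d → ℕ → ℝ) (hφ : ∀ μ, ∑ r ∈ Finset.range F.L, φ μ r = 0)
    {δ : ℝ} (hδ0 : 0 ≤ δ) (hδ : ∀ μ r, |φ μ r| ≤ δ) (hδL : δ ≤ 1 / (40 * (F.L : ℝ))) :
    emlAvgU (bgUnits F K (expHermField (fun b : PBond (F.P K) 0 => (((φ b.dir ((b.src b.dir).val % F.L)) : ℝ) : ℂ) • spinHalfPauli b.dir))) = fun _ => 1 := by
  funext c
  set V := bgUnits F K (expHermField (fun b : PBond (F.P K) 0 => (((φ b.dir ((b.src b.dir).val % F.L)) : ℝ) : ℂ) • spinHalfPauli b.dir)) with hVdef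
  have hLN := L_dvd_sitesPerDir_zero F K
  have hres := residue_property_pauliField F K φ
  have hline := hol_pull_pauliField_line_eq_one F K φ hφ
  refine emlAvgU_apply_eq_one V c ?_ ?_
  · refine eml_coe_units_eq_one_of_involutive_inv_pairing (fun i : Idx (F.P K) => (i.1, i.2.2, i.2.1)) (fun i => rfl) _ ?_ ?_
    · intro i
      refine (norm_loopHolU_pauliField_sub_one_le F K φ hφ hδ0 hδ c i).trans ?_
      have hL1 : (1 : ℝ) < F.L := by exact_mod_cast F.hL.2
      have hL0 : (0 : ℝ) < F.L := by linarith
      have hk : (((F.L - 1) / 2 : ℕ) : ℝ) ≤ F.L := by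
        have : (F.L - 1) / 2 ≤ F.L := by omega
        exact_mod_cast this
      have hδ' : δ * F.L ≤ 1 / 40 := by
        rw [le_div_iff₀ (by positivity)] at hδL
        linarith
      nlinarith
    · intro i
      exact loopHolU_swap_eq_inv hLN V hres hline c i
  · rw [← hol_pull_zero]
    exact hline (emb c.src) 0 c.dir

/-- ★★ hence EVERY ITERATE of the (0.4) tower is trivial on the Pauli field. [cite: Balaban1987RG1, (0.11) p.253] -/
theorem emlIterU_pauliField_eq_one (φ : Fin (F.P K).d → ℕ → ℝ) (hφ : ∀ μ, ∑ r ∈ Finset.range F.L, φ μ r = 0)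
    {δ : ℝ} (hδ0 : 0 ≤ δ) (hδ : ∀ μ r, |φ μ r| ≤ δ) (hδL : δ ≤ 1 / (40 * (F.L : ℝ))) (k : ℕ) (hk : 1 ≤ k) :
    emlIterU k (bgUnits F K (expHermField (fun b : PBond (F.P K) 0 => (((φ b.dir ((b.src b.dir).val % F.L)) : ℝ) : ℂ) • spinHalfPauli b.dir))) = fun _ => 1 :=
  emlIterU_eq_one_of_emlAvgU_eq_one _ (emlAvgU_pauliField_eq_one F K φ hφ hδ0 hδ hδL) k hk

end Assembly

/-! ## §6 The SPEC-0 statements N3a ∕ N3b for the commutator lattice `θ = (1, −1, 0, …)` at amplitude `s` -/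

section Spec

variable (F : T3Family) (K : ℕ)

/-- The profile `θ = (1, −1, 0, …, 0)` sums to zero over a period (`L ≥ 2`). [folklore] -/
theorem sum_range_theta_eq_zero {L : ℕ} (hL : 2 ≤ L) :
    ∑ r ∈ Finset.range L, (if r = 0 then (1 : ℝ) else if r = 1 then -1 else 0) = 0 := by
  obtain ⟨L', rfl⟩ : ∃ L', L = L' + 2 := ⟨L - 2, by omega⟩
  rw [Finset.sum_range_succ', Finset.sum_range_succ']
  simp

/-- ★★★ **SPEC N3a**: ONE (0.4) step averages the commutator lattice `U_s` to the trivial field, for `0 ≤ s ≤ 1∕(40L)`. [cite: Balaban1987RG1, (0.4) p.253] -/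
theorem spec_emlAvgU_field_eq_one (s : ℝ) (hs0 : 0 ≤ s) (hs : s ≤ 1 / (40 * (F.L : ℝ))) :
    emlAvgU (bgUnits F K (expHermField (F := F) (K := K)
      (fun b : PBond (F.P K) 0 =>
        (((s * (if (b.src b.dir).val % F.L = 0 then (1 : ℝ) else if (b.src b.dir).val % F.L = 1 then -1 else 0)) : ℝ) : ℂ) •
          spinHalfPauli b.dir))) = fun _ => 1 := by
  have h := emlAvgU_pauliField_eq_one F K (fun _ r => s * (if r = 0 then (1 : ℝ) else if r = 1 then -1 else 0))
    (fun _ => by rw [← Finset.mul_sum, sum_range_theta_eq_zero (by have := F.hL.2; omega), mul_zero]) hs0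
    (fun _ r => by
      rw [abs_mul, abs_of_nonneg hs0]
      have : |(if r = 0 then (1 : ℝ) else if r = 1 then -1 else 0)| ≤ 1 := by split_ifs <;> simp
      nlinarith) hs
  exact h

/-- ★★★ **SPEC N3b**: hence every iterate `k ≥ 1` of the (0.4) tower is trivial on `U_s`. [cite: Balaban1987RG1, (0.11) p.253] -/
theorem spec_emlIterU_field_eq_one (s : ℝ) (hs0 : 0 ≤ s) (hs : s ≤ 1 / (40 * (F.L : ℝ))) (k : ℕ) (hk : 1 ≤ k) :
    emlIterU k (bgUnits F K (expHermField (F := F) (K := K)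
      (fun b : PBond (F.P K) 0 =>
        (((s * (if (b.src b.dir).val % F.L = 0 then (1 : ℝ) else if (b.src b.dir).val % F.L = 1 then -1 else 0)) : ℝ) : ℂ) •
          spinHalfPauli b.dir))) = fun _ => 1 :=
  emlIterU_eq_one_of_emlAvgU_eq_one _ (spec_emlAvgU_field_eq_one F K s hs0 hs) k hk

end Spec

end Summit.QuantumFields.YangMills.Theorems.Prop7HPcolNegCommutatorLattice

end
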